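import Mathlib
import Summits.NavierStokesRegularity.NavierStokesRegularity.Theorems.EulerZoomLiouvillePowerGaugeEulerLiouvilleHoopSliceSides
import Summits.NavierStokesRegularity.NavierStokesRegularity.Theorems.EulerZoomLiouvillePowerGaugeEulerLiouvilleHoopAxisAtom
import HarnessLib

/-!
# HOOP LINE, K-AXIS plate AX-4 (part 1) — the `σ`-integration of the fixed-height axis law
# (route `EulerZoomLiouville`, crux E = stmt-NavierStokesRegularity-19832; class-free calculus, `--supports` only)

The K-AXIS split of LEAD 19832 (ns-typeII-p2 g14, key 01:50:27Z): AX-1 frame (ns-ezl-w3 g6), AX-2 circle-averaged radial law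
(LEAD, `…HoopAxisRadialLaw`), AX-3 `t`-integration with the axis atom (ns-ezl-w3 g7 `…HoopAxisAtom`; LEAD `…HoopAxisRadialIntegrated`: the FIXED-HEIGHT law
`axisLaw_slice`: `P(σe_z) − ⟨P⟩_θ(σ,T₀) = ∫₀^{T₀}⟨V_r² − V_θ²⟩dt/t − ½‖V_⊥(σe_z)‖² + (1−3γ)∫₀^{T₀}⟨V_r⟩dt + ⟨(γt + V_r)V_r⟩(σ,T₀) + K(σ)`),
and AX-4 = THIS plate (ns-sfl-p1 g8): integrate the fixed-height law over `σ ∈ [s₁, s₂]` to obtain the integrated form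
`HoopCore.AxisLawCentre γ` / `AxisLawIntegrated γ` of `…HoopDefs` VERBATIM.

This file is the part of AX-4 that does not depend on the fixed-height law itself: the `σ`-regularity of the five `σ`-integrands
and the generic integration lemma.
* `axisHoopTerm_eq_sliceLHS` — `∫₀^{T₀} ⟨V_r² − V_θ²⟩(σ,t) dt/t = (2π)⁻¹ ∫₀^{T₀} t⁻¹∫₀^{2π}(a² − b²)` (the hoop term IS the slice
  functional of the hoop inequality), hence `intervalIntegrable_axisHoopTerm` (from `intervalIntegrable_sliceLHS`);
* `axisRadialTerm_eq_chart`, `continuous_axisRadialTerm` — `σ ↦ ∫₀^{T₀} ⟨V_r⟩(σ,t) dt` is continuous;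
* `continuous_axisLateralTerm` — `σ ↦ ⟨(γ r + V_r)V_r⟩(σ, T₀)` is continuous (`T₀ > 0`);
* `continuous_axisAtomTerm` — `σ ↦ ‖V(σe_z)‖² − V_z(σe_z)²`; `continuous_axisLHS` — `σ ↦ P(σe_z) − ⟨P⟩_θ(σ, T₀)`;
* **`integral_axisLaw_of_fixed`** — if the fixed-height law holds on `[s₁, s₂]` with an interval-integrable end density `K`,
  then the law integrates term by term (linearity of the interval integral; the end density stays as `∫ K`).
Part 2 (`…HoopAxisLawCentre`) applies it to LEAD 19832's `axisLaw_slice` (`…HoopAxisRadialIntegrated`) BY NAME and identifies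
`∫ K = [endTermC]_{s₁}^{s₂} − [offsetTerm]_{s₁}^{s₂}` (differentiation under `∫₀^{T₀} dt` + FTC in `σ`).

HONEST FRAME: bookkeeping for a class-free identity about hypothetical self-similar profiles; 19832 OPEN; NS regularity NOT proved;
not E.  [HOOP-NOTE §2/§8 (ns-idea-11 g8); folklore (Fubini/FTC)]
-/

noncomputable section

open MeasureTheory Set WithLp Metric Real Function
open scoped InnerProductSpace RealInnerProductSpace

set_option linter.dupNamespace false

namespace Summit.NavierStokesRegularity.NavierStokesRegularity.Theorems.PowerGaugeEulerLiouville.HoopCore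

open Literature.Analysis Literature.Analysis.FluidPDE Condenser

variable {V : EuclideanSpace ℝ (Fin 3) → EuclideanSpace ℝ (Fin 3)}

/-! ## The hoop term `∫₀^{T₀} ⟨V_r² − V_θ²⟩ dt/t` is the slice functional -/

/-- Pointwise in `t ≥ 0`: `⟨V_r² − V_θ²⟩(σ,t)/t = (2π)⁻¹ · t⁻¹ ∫₀^{2π}(a² − b²)` (chart form `circleAvg_hoop_eq_chart` for `t > 0`;
both sides vanish at `t = 0`). [folklore] -/
theorem circleAvg_hoop_div_eq_sliceLHS (V : EuclideanSpace ℝ (Fin 3) → EuclideanSpace ℝ (Fin 3)) (σ : ℝ) {t : ℝ}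
    (ht : 0 ≤ t) :
    circleAvg (fun y => radialVelocity V y ^ 2 - swirlVelocity V y ^ 2) σ t / t =
      1 / (2 * Real.pi) * (t⁻¹ * ∫ θ in (0 : ℝ)..2 * π,
        (⟪V (axisPt σ t θ), rotZ θ (EuclideanSpace.single (0 : Fin 3) (1 : ℝ))⟫ ^ 2 -
          ⟪V (axisPt σ t θ), rotZ θ (EuclideanSpace.single (1 : Fin 3) (1 : ℝ))⟫ ^ 2)) := by
  rcases eq_or_lt_of_le ht with h | h
  · simp [← h]
  · rw [circleAvg_hoop_eq_chart V σ h, div_eq_mul_inv]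
    ring

/-- **The hoop term is the slice functional**: `∫₀^{T₀} ⟨V_r² − V_θ²⟩(σ,t) dt/t = (2π)⁻¹ ∫₀^{T₀} t⁻¹ ∫₀^{2π} (a² − b²) dθ dt`
(`T₀ ≥ 0`). [folklore] -/
theorem axisHoopTerm_eq_sliceLHS (V : EuclideanSpace ℝ (Fin 3) → EuclideanSpace ℝ (Fin 3)) (σ : ℝ) {T₀ : ℝ}
    (hT₀ : 0 ≤ T₀) :
    ∫ t in (0 : ℝ)..T₀, circleAvg (fun y => radialVelocity V y ^ 2 - swirlVelocity V y ^ 2) σ t / t =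
      1 / (2 * Real.pi) * ∫ t in (0 : ℝ)..T₀, t⁻¹ * ∫ θ in (0 : ℝ)..2 * π,
        (⟪V (axisPt σ t θ), rotZ θ (EuclideanSpace.single (0 : Fin 3) (1 : ℝ))⟫ ^ 2 -
          ⟪V (axisPt σ t θ), rotZ θ (EuclideanSpace.single (1 : Fin 3) (1 : ℝ))⟫ ^ 2) := by
  rw [← intervalIntegral.integral_const_mul]
  refine intervalIntegral.integral_congr fun t ht => ?_
  rw [uIcc_of_le hT₀] at ht
  exact circleAvg_hoop_div_eq_sliceLHS V σ ht.1

/-- **`σ`-integrability of the hoop term** on `[s₁, s₂]` (`V ∈ C¹`, `s₁ ≤ s₂`, `T₀ > 0`), from `intervalIntegrable_sliceLHS`. [folklore] -/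
theorem intervalIntegrable_axisHoopTerm (hV : ContDiff ℝ 1 V) {s₁ s₂ T₀ : ℝ} (hs : s₁ ≤ s₂) (hT₀ : 0 < T₀) :
    IntervalIntegrable (fun σ : ℝ => ∫ t in (0 : ℝ)..T₀,
      circleAvg (fun y => radialVelocity V y ^ 2 - swirlVelocity V y ^ 2) σ t / t) volume s₁ s₂ := by
  have e : (fun σ : ℝ => ∫ t in (0 : ℝ)..T₀,
      circleAvg (fun y => radialVelocity V y ^ 2 - swirlVelocity V y ^ 2) σ t / t) =
      fun σ : ℝ => 1 / (2 * Real.pi) * ∫ t in (0 : ℝ)..T₀, t⁻¹ * ∫ θ in (0 : ℝ)..2 * π,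
        (⟪V (axisPt σ t θ), rotZ θ (EuclideanSpace.single (0 : Fin 3) (1 : ℝ))⟫ ^ 2 -
          ⟪V (axisPt σ t θ), rotZ θ (EuclideanSpace.single (1 : Fin 3) (1 : ℝ))⟫ ^ 2) :=
    funext fun σ => axisHoopTerm_eq_sliceLHS V σ hT₀.le
  rw [e]
  exact (intervalIntegrable_sliceLHS hV hs hT₀).const_mul (1 / (2 * Real.pi))

/-! ## The radial term `∫₀^{T₀} ⟨V_r⟩ dt`, the lateral term, the atom and the left side are continuous in `σ` -/

/-- Chart form of the radial term: `∫₀^{T₀} ⟨V_r⟩(σ,t) dt = ∫₀^{T₀} (2π)⁻¹∫₀^{2π} ⟪V(axisPt σ t θ), R_θe₀⟫ dθ dt` (`T₀ ≥ 0`; the two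
integrands agree for `t > 0`, `circleAvg_radialVelocity_eq_chart`). [folklore] -/
theorem axisRadialTerm_eq_chart (V : EuclideanSpace ℝ (Fin 3) → EuclideanSpace ℝ (Fin 3)) (σ : ℝ) {T₀ : ℝ} (hT₀ : 0 ≤ T₀) :
    ∫ t in (0 : ℝ)..T₀, circleAvg (radialVelocity V) σ t =
      ∫ t in (0 : ℝ)..T₀, 1 / (2 * Real.pi) * ∫ θ in (0 : ℝ)..2 * Real.pi,
        ⟪V (axisPt σ t θ), rotZ θ (EuclideanSpace.single (0 : Fin 3) (1 : ℝ))⟫ := by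
  refine intervalIntegral.integral_congr_ae (ae_of_all _ fun t ht => ?_)
  rw [uIoc_of_le hT₀] at ht
  exact circleAvg_radialVelocity_eq_chart V σ ht.1

/-- **The radial term is continuous in the height** (`V` continuous, `T₀ ≥ 0`). [folklore] -/
theorem continuous_axisRadialTerm (hV : Continuous V) {T₀ : ℝ} (hT₀ : 0 ≤ T₀) :
    Continuous fun σ : ℝ => ∫ t in (0 : ℝ)..T₀, circleAvg (radialVelocity V) σ t := by
  have e : (fun σ : ℝ => ∫ t in (0 : ℝ)..T₀, circleAvg (radialVelocity V) σ t) =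
      fun σ : ℝ => ∫ t in (0 : ℝ)..T₀, 1 / (2 * Real.pi) * ∫ θ in (0 : ℝ)..2 * Real.pi,
        ⟪V (axisPt σ t θ), rotZ θ (EuclideanSpace.single (0 : Fin 3) (1 : ℝ))⟫ :=
    funext fun σ => axisRadialTerm_eq_chart V σ hT₀
  rw [e]
  have hI : Continuous fun q : ℝ × ℝ => ∫ θ in (0 : ℝ)..2 * Real.pi,
      ⟪V (axisPt q.1 q.2 θ), rotZ θ (EuclideanSpace.single (0 : Fin 3) (1 : ℝ))⟫ :=
    intervalIntegral.continuous_parametric_intervalIntegral_of_continuous' (continuous_uncurry_pair (continuous_sliceA hV)) _ _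
  exact intervalIntegral.continuous_parametric_intervalIntegral_of_continuous' (continuous_const.mul hI) _ _

/-- **The lateral term `σ ↦ ⟨(γ r + V_r) V_r⟩(σ, T₀)` is continuous in the height** (`V` continuous, `T₀ > 0`; chart form
`circleAvg_lateral_eq_chart`). [folklore] -/
theorem continuous_axisLateralTerm (hV : Continuous V) (γ : ℝ) {T₀ : ℝ} (hT₀ : 0 < T₀) :
    Continuous fun σ : ℝ =>
      circleAvg (fun y => (γ * cylRadius y + radialVelocity V y) * radialVelocity V y) σ T₀ := by
  have e : (fun σ : ℝ => circleAvg (fun y => (γ * cylRadius y + radialVelocity V y) * radialVelocity V y) σ T₀) =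
      fun σ : ℝ => 1 / (2 * Real.pi) * ∫ θ in (0 : ℝ)..2 * Real.pi,
        (γ * T₀ + ⟪V (axisPt σ T₀ θ), rotZ θ (EuclideanSpace.single (0 : Fin 3) (1 : ℝ))⟫) *
          ⟪V (axisPt σ T₀ θ), rotZ θ (EuclideanSpace.single (0 : Fin 3) (1 : ℝ))⟫ :=
    funext fun σ => circleAvg_lateral_eq_chart V γ σ hT₀
  rw [e]
  have hF : Continuous fun p : ℝ × ℝ × ℝ =>
      (γ * p.2.1 + ⟪V (axisPt p.1 p.2.1 p.2.2), rotZ p.2.2 (EuclideanSpace.single (0 : Fin 3) (1 : ℝ))⟫) *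
        ⟪V (axisPt p.1 p.2.1 p.2.2), rotZ p.2.2 (EuclideanSpace.single (0 : Fin 3) (1 : ℝ))⟫ :=
    ((continuous_const.mul (continuous_fst.comp continuous_snd)).add (continuous_sliceA hV)).mul (continuous_sliceA hV)
  exact continuous_const.mul
    (intervalIntegral.continuous_parametric_intervalIntegral_of_continuous' (continuous_uncurry_radius hF T₀) _ _)

/-- The atom term `σ ↦ ‖V(σe_z)‖² − V_z(σe_z)²` is continuous (`V` continuous). [folklore] -/
theorem continuous_axisAtomTerm (hV : Continuous V) :
    Continuous fun σ : ℝ => ‖V (σ • eZ)‖ ^ 2 - axialVelocity V (σ • eZ) ^ 2 := by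
  have hv : Continuous fun σ : ℝ => V (σ • eZ) := hV.comp (continuous_id.smul continuous_const)
  unfold axialVelocity
  exact (hv.norm.pow 2).sub (((PiLp.continuous_apply 2 _ 2).comp hv).pow 2)

/-- The left side `σ ↦ P(σe_z) − ⟨P⟩_θ(σ, T₀)` is continuous (`P` continuous; LEAD's `continuous_circleAvg_height`). [folklore] -/
theorem continuous_axisLHS {P : EuclideanSpace ℝ (Fin 3) → ℝ} (hP : Continuous P) (T₀ : ℝ) :
    Continuous fun σ : ℝ => P (σ • eZ) - circleAvg P σ T₀ :=
  (hP.comp (continuous_id.smul continuous_const)).sub (continuous_circleAvg_height hP T₀)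

/-! ## The generic `σ`-integration -/

/-- **AX-4, generic form: the `σ`-integration of a fixed-height axis law.**  Let `V ∈ C¹`, `s₁ ≤ s₂`, `T₀ > 0`, and suppose that
at every height `σ ∈ [s₁, s₂]` the fixed-height law
`P(σe_z) − ⟨P⟩_θ(σ,T₀) = ∫₀^{T₀}⟨V_r²−V_θ²⟩dt/t − ½(‖V(σe_z)‖² − V_z(σe_z)²) + (1−3γ)∫₀^{T₀}⟨V_r⟩dt + ⟨(γr+V_r)V_r⟩(σ,T₀) + K(σ)`
holds with an interval-integrable end density `K` (for LEAD 19832's `axisLaw_slice`: `K(σ) = ∫₀^{T₀}(∂_σ e − γ ∂_σ o) dt`, the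
`σ`-derivatives of the slice forms of the `endTermC` / `offsetTerm` integrands).  Then the law integrates term by term over
`[s₁, s₂]` (every other `σ`-integrand is interval-integrable by the lemmas above); part 2 identifies `∫ K` with
`[endTermC]_{s₁}^{s₂} − [offsetTerm]_{s₁}^{s₂}`. [folklore] -/
theorem integral_axisLaw_of_fixed (hV : ContDiff ℝ 1 V) {P : EuclideanSpace ℝ (Fin 3) → ℝ} (γ : ℝ) {K : ℝ → ℝ}
    {s₁ s₂ T₀ : ℝ} (hs : s₁ ≤ s₂) (hT₀ : 0 < T₀)
    (hfix : ∀ σ ∈ uIcc s₁ s₂, P (σ • eZ) - circleAvg P σ T₀ =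
      (∫ t in (0 : ℝ)..T₀, circleAvg (fun y => radialVelocity V y ^ 2 - swirlVelocity V y ^ 2) σ t / t)
        - (1 / 2) * (‖V (σ • eZ)‖ ^ 2 - axialVelocity V (σ • eZ) ^ 2)
        + (1 - 3 * γ) * (∫ t in (0 : ℝ)..T₀, circleAvg (radialVelocity V) σ t)
        + circleAvg (fun y => (γ * cylRadius y + radialVelocity V y) * radialVelocity V y) σ T₀
        + K σ)
    (hK : IntervalIntegrable K volume s₁ s₂) :
    ∫ σ in s₁..s₂, (P (σ • eZ) - circleAvg P σ T₀)
      = (∫ σ in s₁..s₂, ∫ t in (0 : ℝ)..T₀,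
            circleAvg (fun y => radialVelocity V y ^ 2 - swirlVelocity V y ^ 2) σ t / t)
        - (1 / 2) * (∫ σ in s₁..s₂, (‖V (σ • eZ)‖ ^ 2 - axialVelocity V (σ • eZ) ^ 2))
        + (1 - 3 * γ) * (∫ σ in s₁..s₂, ∫ t in (0 : ℝ)..T₀, circleAvg (radialVelocity V) σ t)
        + (∫ σ in s₁..s₂, circleAvg (fun y => (γ * cylRadius y + radialVelocity V y) * radialVelocity V y) σ T₀)
        + (∫ σ in s₁..s₂, K σ) := by
  have hVc : Continuous V := hV.continuous
  -- the five `σ`-integrands are interval-integrable on `[s₁, s₂]`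
  have i1 : IntervalIntegrable (fun σ : ℝ => ∫ t in (0 : ℝ)..T₀,
      circleAvg (fun y => radialVelocity V y ^ 2 - swirlVelocity V y ^ 2) σ t / t) volume s₁ s₂ :=
    intervalIntegrable_axisHoopTerm hV hs hT₀
  have i2 : IntervalIntegrable (fun σ : ℝ => (1 / 2) * (‖V (σ • eZ)‖ ^ 2 - axialVelocity V (σ • eZ) ^ 2))
      volume s₁ s₂ := ((continuous_axisAtomTerm hVc).intervalIntegrable _ _).const_mul _
  have i3 : IntervalIntegrable (fun σ : ℝ => (1 - 3 * γ) * ∫ t in (0 : ℝ)..T₀, circleAvg (radialVelocity V) σ t)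
      volume s₁ s₂ := ((continuous_axisRadialTerm hVc hT₀.le).intervalIntegrable _ _).const_mul _
  have i4 : IntervalIntegrable (fun σ : ℝ =>
      circleAvg (fun y => (γ * cylRadius y + radialVelocity V y) * radialVelocity V y) σ T₀) volume s₁ s₂ :=
    (continuous_axisLateralTerm hVc γ hT₀).intervalIntegrable _ _
  -- integrate the fixed-height law
  rw [intervalIntegral.integral_congr (fun σ hσ => hfix σ hσ),
    intervalIntegral.integral_add (((i1.sub i2).add i3).add i4) hK,
    intervalIntegral.integral_add ((i1.sub i2).add i3) i4, intervalIntegral.integral_add (i1.sub i2) i3,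
    intervalIntegral.integral_sub i1 i2, intervalIntegral.integral_const_mul, intervalIntegral.integral_const_mul]

end Summit.NavierStokesRegularity.NavierStokesRegularity.Theorems.PowerGaugeEulerLiouville.HoopCore

end
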